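import Literature.AlgebraicGeometry.HodgeTheory.HodgeGroupSemisimpleOfNoTypeIVFactor
import HarnessLib

/-!
# `End(V_X)^{G_div(X)} = End⁰(X) ⊗ ℂ` and the centre of `G_div(X)` for `G_div` read as Milne's `S(A)(h)(ℂ)`
# (Moonen–Zarhin 1998, §1 Lemma (3) first clause and Lemma (1), types I–III)

Layer `Literature/AlgebraicGeometry/HodgeTheory`; THEOREMS ONLY (no definition, no named fact; D-0026 net
debt 0). Sequel of `HodgeGroupSemisimpleOfNoTypeIVFactor` (the same argument for the Hodge group) and of
`WeilClassesFieldDecomposableIffLefschetzGroup` (which reads Moonen–Zarhin's `G_div(X)(ℂ)` as Milne's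
`S(A)(h)(ℂ) = Milne1999.unitaryCentralizerGroup A h`: the automorphisms of `H¹(A(ℂ); ℂ)` commuting with every
pull-back `φ^*`, `φ ∈ End(A)`, and preserving the polarization pairing `Q_h`).

## The print

B. J. J. Moonen, Yu. G. Zarhin, *Weil classes on abelian varieties*, J. reine angew. Math. **496** (1998) =
arXiv:alg-geom/9612017 [MoonenZarhin1998WeilClasses], §1 (held text `paper:arxiv-alg-geom_9612017`, chunks
p0002–p0003).  `X ∼ Y^m`, `Y` simple, `D = End⁰(Y)`, `E = Z(D)`, `B ⊆ End⁰(X)` the subalgebra generated by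
the Rosati-symmetric elements, `G_div(X) := Gl_B(V) ∩ Sp(V, φ)` «the largest algebraic subgroup of `Gl(V)`
defined over `ℚ` which leaves invariant all divisor classes» (p0002), «if `m ≥ 2` or if `X` is of type 1 or
2, then we simply have `Δ = D`» (so `B = End⁰(X)` and `G_div(X)` is the centralizer of `End⁰(X)` in
`Sp(V, φ)` — Milne's `S(A)`).  VERBATIM:

> «Lemma. (1) The center of `G_div(X)` is the group `U_{K_B}` given by
> `U_{K_B}(R) = {a ∈ (K_B ⊗_ℚ R)^* | a a† = 1}`. For `X` of type 4 with either `d ≥ 2` or `m ≥ 2` this is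
> a connected torus of rank `e₀`; in all other cases it is finite. […]
> (3) `End(V_X)^{G_div(X)} = B`; `(⋀² V_X)^{G_div(X)} = 𝓑¹(X)`, and `(⊕ᵢ ⋀ⁱ V_X)^{G_div(X)} = 𝒟^•(X)`.»

## What is proved (on the carrier `H¹(A(ℂ); ℂ)`, `G_div := S(A)(h)(ℂ)`)

For a complex abelian variety `A` and a class `h ∈ B¹(A) ⊗ ℂ = hodgeClassSpan A.dim A.X 1` (e.g. a rational
class of type `(1,1)`), so that `Hg(A)(ℂ)|_{H¹} ≤ S(A)(h)(ℂ)` (`Milne1999.hodgeGroupOne_le_unitaryCentralizerGroup`):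

* §1 **Lemma (3), first clause, for `B = End⁰(X)`**: an endomorphism of `H¹(A(ℂ); ℂ)` commuting with every
  `u ∈ S(A)(h)(ℂ)` is a `ℂ`-combination of pull-backs `φ^*` (`mem_span_pullbackOne_of_forall_mem_unitaryCentralizerGroup_comm`,
  through Deligne's commutant theorem `Deligne1982.mem_span_complexBetti_map_of_commute_hodgeGroup`, PROVED in
  the tree from Deligne–Milne II 6.20), and conversely (`comm_of_mem_span_pullbackOne`); so
  **`End(H¹)^{S(A)(h)(ℂ)} = End⁰(A) ⊗ ℂ`** read on `H¹` (`mem_span_pullbackOne_iff_forall_mem_unitaryCentralizerGroup_comm`).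
* §2 **Lemma (1), «the center of `G_div(X)` is [inside] `U_{K_B}`»**: a central `z ∈ S(A)(h)(ℂ)` commutes with
  `Hg(A)(ℂ)` and with every `φ^*`, hence lies in the `ℂ`-span of the CENTRAL pull-backs `u^* ∈ C(A) ⊗ ℂ`
  (`coe_mem_span_central_pullbackOne_of_mem_center_unitaryCentralizerGroup`, through
  `HodgeGroupSemisimple.mem_span_pullbackOne_of_commute`) — `Z(G_div) ⊂ (Z(End⁰ X) ⊗ ℂ)^×`; the torus
  structure of `U_{K_B}` is NOT formalised.
* §3 **Lemma (1), «in all other cases it is finite», for `A` with no factor of type IV** (`HasNoTypeIVFactor A`: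
  central endomorphisms have real spectrum — types 1–3) and `h` a polarization class (rational, type `(1,1)`,
  hard Lefschetz, Hodge–Riemann positive in degree one — the output of `HodgeGroupSemisimple.exists_polarizationClass`):
  every central `z ∈ S(A)(h)(ℂ)` satisfies **`z² = 1`** (`mul_self_eq_one_of_mem_center_unitaryCentralizerGroup`:
  `z` is `Q_h`-symmetric by `HodgeGroupSemisimple.isAdj_self_pullbackOne` — the Rosati involution is trivial on a
  totally real centre — and `Q_h`-orthogonal), and **the centre of `S(A)(h)(ℂ)` is finite**
  (`finite_center_unitaryCentralizerGroup`; `exists_finite_center_unitaryCentralizerGroup` packages the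
  polarization class for `dim A ≥ 1`).  The type-4 clause (a torus of rank `e₀`) and the type-3, `m = 1` case
  where `B ⊊ D` (so that `G_div ⊋ S(A)`) are NOT covered: here `G_div` IS Milne's `S(A)(h)`, as in the seat's
  `WeilClassesFieldDecomposableIffLefschetzGroup`.

Part 0 (`LefschetzGroupCentre.finite_of_comm_of_mul_self_eq_one`, a commutative group of involutions of a
finite-dimensional complex vector space is finite) is a private copy of the corresponding private lemma of
`HodgeGroupSemisimpleOfNoTypeIVFactor` (not exported there). [folklore]

## References

* [MoonenZarhin1998WeilClasses] B. J. J. Moonen, Yu. G. Zarhin, *Weil classes on abelian varieties*,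
  J. reine angew. Math. 496 (1998) 83–92 = arXiv:alg-geom/9612017, §1: definition of `G_div(X)` and Table 1
  (chunk p0002), Lemma (1) and (3) (chunks p0002–p0003).
* [Milne1999LefschetzClasses] J. S. Milne, *Lefschetz classes on abelian varieties*, Duke Math. J. 96 (1999),
  §1 p. 644 (`S(A)`), §4 Thm. 4.4 — the tree's `Milne1999.unitaryCentralizerGroup`.
* [Deligne1982HodgeCycles] P. Deligne, *Hodge cycles on abelian varieties*, LNM 900 (1982), I Prop. 3.4 —
  the tree's `Deligne1982.mem_span_complexBetti_map_of_commute_hodgeGroup`.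
* [MoonenZarhin1999LowDim] B. Moonen, Yu. Zarhin, Math. Ann. 315 (1999), §1 («If `X` has no factors of Type 4
  then `Hg(X)` is semi-simple») — the sister statement `HodgeGroupSemisimple.finite_center_hodgeGroupOne`.

## Provenance

Lane `lit-hodgefound` (Track 2, Layer A), prover seat `lit-hodgefound-p21` (generation 13), row g13-#2; sequel
of Q1913 (`WeilClassesFieldDecomposableIffLefschetzGroup`) and of `HodgeGroupSemisimpleOfNoTypeIVFactor`.
-/

noncomputable section

namespace Literature.AlgebraicGeometry.HodgeTheory

namespace LefschetzGroupCentre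

open Module

/-! ### Part 0. A commutative group of involutions of a finite-dimensional space is finite (private copy) -/

section Involutions

variable {V : Type*} [AddCommGroup V] [Module ℂ V]

/-- For an involution `T` (`T² = 1`), generalized eigenvectors are eigenvectors (private copy of the
lemma of `HodgeGroupSemisimpleOfNoTypeIVFactor`). [folklore] -/
private theorem apply_eq_smul_of_pow_apply_eq_zero_of_sq {T : Module.End ℂ V} (hT : T * T = 1) {c : ℂ} :
    ∀ (k : ℕ) (v : V), ((T - c • 1) ^ k) v = 0 → T v = c • v
  | 0, v, hv => by
    simp only [pow_zero, Module.End.one_apply] at hv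
    rw [hv, map_zero, smul_zero]
  | k + 1, v, hv => by
    rw [pow_succ, Module.End.mul_apply] at hv
    have hTu := apply_eq_smul_of_pow_apply_eq_zero_of_sq hT k _ hv
    have hTT : ∀ w, T (T w) = w := fun w ↦ by rw [← Module.End.mul_apply, hT, Module.End.one_apply]
    have hu : (T - c • 1) v = T v - c • v := by simp
    rw [hu] at hTu
    by_cases hc : c * c = 1
    · have e1 : v - c • T v = c • T v - (c * c) • v := by
        rw [mul_smul, ← smul_sub, ← hTu, map_sub, hTT, map_smul]
      rw [hc, one_smul, sub_eq_sub_iff_add_eq_add, ← two_smul ℂ, ← two_smul ℂ] at e1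
      have e2 : v = c • T v := smul_right_injective V (two_ne_zero (α := ℂ)) e1
      calc T v = T (c • T v) := by rw [← e2]
        _ = c • v := by rw [map_smul, hTT]
    · set u := T v - c • v with hudef
      have h3 : T u = c • u := hTu
      have h2 : u = (c * c) • u := by
        have := hTT u
        rw [h3, map_smul, h3, smul_smul] at this
        exact this.symm
      have e3 : (1 - c * c) • u = 0 := by rw [sub_smul, one_smul, ← h2, sub_self]
      have hu0 : u = 0 := by
        rcases smul_eq_zero.1 e3 with h | h
        · exact absurd (sub_eq_zero.1 h).symm hc
        · exact h
      rw [hudef] at hu0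
      exact sub_eq_zero.1 hu0

variable [FiniteDimensional ℂ V]

/-- **A commutative subgroup of `GL(V)` consisting of involutions is finite** (`V` a finite-dimensional
complex vector space): its elements act by scalars `±1` on the finitely many simultaneous eigenspaces,
which span `V` (private copy of the lemma of `HodgeGroupSemisimpleOfNoTypeIVFactor`). [folklore] -/
private theorem finite_of_comm_of_mul_self_eq_one (G : Subgroup (V ≃ₗ[ℂ] V))
    (hcomm : ∀ a ∈ G, ∀ b ∈ G, a * b = b * a) (hsq : ∀ a ∈ G, a * a = 1) : Finite G := by
  classical
  let f : G → Module.End ℂ V := fun a ↦ ((a : V ≃ₗ[ℂ] V) : Module.End ℂ V)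
  have hf1 : ∀ a : G, f a * f a = 1 := fun a ↦ by
    refine LinearMap.ext fun v ↦ ?_
    have h := LinearEquiv.congr_fun (hsq a a.2) v
    rw [LinearEquiv.mul_apply] at h
    rw [Module.End.mul_apply, Module.End.one_apply]
    exact h
  have hfc : ∀ a b : G, Commute (f a) (f b) := fun a b ↦ by
    refine LinearMap.ext fun v ↦ ?_
    have h := LinearEquiv.congr_fun (hcomm a a.2 b b.2) v
    rw [LinearEquiv.mul_apply, LinearEquiv.mul_apply] at h
    change f a (f b v) = f b (f a v)
    exact h
  let P : (G → ℂ) → Submodule ℂ V := fun χ ↦ ⨅ a, (f a).maxGenEigenspace (χ a)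
  have hind : iSupIndep P :=
    Module.End.independent_iInf_maxGenEigenspace_of_forall_mapsTo f fun a b φ ↦
      Module.End.mapsTo_maxGenEigenspace_of_comm (hfc b a) φ
  have htop : ⨆ χ, P χ = ⊤ :=
    Module.End.iSup_iInf_maxGenEigenspace_eq_top_of_iSup_maxGenEigenspace_eq_top_of_commute f
      (fun a b _ ↦ hfc a b) fun a ↦ Module.End.iSup_maxGenEigenspace_eq_top (f a)
  have hact : ∀ (χ : G → ℂ) (a : G), ∀ v ∈ P χ, f a v = χ a • v := by
    intro χ a v hv
    have hv' : v ∈ (f a).maxGenEigenspace (χ a) := (Submodule.mem_iInf _).1 hv a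
    obtain ⟨k, hk⟩ := (Module.End.mem_maxGenEigenspace _ _ _).1 hv'
    exact apply_eq_smul_of_pow_apply_eq_zero_of_sq (hf1 a) k v hk
  haveI : Fintype {χ : G → ℂ // P χ ≠ ⊥} := hind.fintypeNeBotOfFiniteDimensional
  have hSfin : ({c : ℂ | c ^ 2 = 1} : Set ℂ).Finite := by
    refine (Multiset.finite_toSet (Polynomial.nthRoots 2 (1 : ℂ))).subset fun x hx ↦ ?_
    exact (Polynomial.mem_nthRoots two_pos).2 hx
  haveI : Finite {c : ℂ // c ^ 2 = 1} := hSfin.to_subtype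
  have hval : ∀ (χ : {χ : G → ℂ // P χ ≠ ⊥}) (a : G), (χ.1 a) ^ 2 = 1 := by
    intro χ a
    obtain ⟨v, hv, hv0⟩ := Submodule.exists_mem_ne_zero_of_ne_bot χ.2
    have h1 := hact χ.1 a v hv
    have h2 : f a (f a v) = v := by rw [← Module.End.mul_apply, hf1, Module.End.one_apply]
    rw [h1, map_smul, h1, smul_smul] at h2
    have : (χ.1 a ^ 2 - 1) • v = 0 := by rw [sub_smul, one_smul, sq, h2, sub_self]
    rcases smul_eq_zero.1 this with h | h
    · exact sub_eq_zero.1 h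
    · exact absurd h hv0
  let F : G → ({χ : G → ℂ // P χ ≠ ⊥} → {c : ℂ // c ^ 2 = 1}) := fun a χ ↦ ⟨χ.1 a, hval χ a⟩
  refine Finite.of_injective F fun a b hab ↦ ?_
  apply Subtype.ext
  refine LinearEquiv.ext fun v ↦ ?_
  have hv : v ∈ ⨆ χ, P χ := by rw [htop]; exact Submodule.mem_top
  refine Submodule.iSup_induction (motive := fun v ↦ (a : V ≃ₗ[ℂ] V) v = (b : V ≃ₗ[ℂ] V) v) P hv
    ?_ ?_ ?_
  · intro χ v hv
    by_cases hχ : P χ = ⊥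
    · rw [hχ, Submodule.mem_bot] at hv
      rw [hv, map_zero, map_zero]
    · have e : χ a = χ b := congrArg Subtype.val (congr_fun hab ⟨χ, hχ⟩)
      change f a v = f b v
      rw [hact χ a v hv, hact χ b v hv, e]
  · rw [map_zero, map_zero]
  · intro x y hx hy
    rw [map_add, map_add, hx, hy]

end Involutions

end LefschetzGroupCentre

/-! ## Part 1. `End(H¹)^{S(A)(h)(ℂ)} = End⁰(A) ⊗ ℂ` (Lemma (3), first clause) -/

open CategoryTheory
open Literature.AlgebraicTopology.SingularHomology
open Literature.AlgebraicGeometry.Motives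
open Literature.AlgebraicGeometry.VanGeemen1994 (pullbackOne hodgeGroupOne mem_hodgeGroupOne_iff hodgeClassSpan)
open Literature.AlgebraicGeometry.Milne1999 (centralizerAlgebra centralizerGroup unitaryCentralizerGroup
  mem_centralizerGroup_iff hodgeGroupOne_le_unitaryCentralizerGroup unitaryCentralizerGroup_le_centralizerGroup)
open Literature.Geometry.Kaehler (HasHardLefschetzProperty)

variable {A : AbelianVariety ℂ} {h : complexBetti A.X 2}

/-- **Moonen–Zarhin 1998, Lemma (3), first clause «`End(V_X)^{G_div(X)} = B`», inclusion `⊆`, with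
`G_div(X)(ℂ)` read as Milne's `S(A)(h)(ℂ)`** (for which `B = End⁰(X)`: the case `m ≥ 2` or types 1, 2 of
Table 1): for `h ∈ B¹(A) ⊗ ℂ`, an endomorphism of `H¹(A(ℂ); ℂ)` commuting with every `u ∈ S(A)(h)(ℂ)`
commutes with `Hg(A)(ℂ)|_{H¹} ≤ S(A)(h)(ℂ)` and therefore lies in the `ℂ`-span of the pull-backs `φ^*`,
`φ ∈ End(A)` (Deligne I Prop. 3.4 + Riemann, the tree's `Deligne1982.mem_span_complexBetti_map_of_commute_hodgeGroup`).
[cite: MoonenZarhin1998WeilClasses, §1 Lemma (3) (chunk p0003)] [cite: Deligne1982HodgeCycles, I §3, Prop. 3.4] -/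
theorem mem_span_pullbackOne_of_forall_mem_unitaryCentralizerGroup_comm (hh : h ∈ hodgeClassSpan A.dim A.X 1)
    (T : Module.End ℂ (complexBetti A.X 1))
    (hT : ∀ u ∈ unitaryCentralizerGroup A h, ∀ y : complexBetti A.X 1, T (u y) = u (T y)) :
    T ∈ Submodule.span ℂ (Set.range fun φ : A ⟶ A ↦ pullbackOne A φ) :=
  Deligne1982.mem_span_complexBetti_map_of_commute_hodgeGroup A T fun g hg y ↦
    hT (g 1) (hodgeGroupOne_le_unitaryCentralizerGroup hh (mem_hodgeGroupOne_iff.2 ⟨g, hg, rfl⟩)) y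

/-- **Lemma (3), first clause, inclusion `⊇`** (tautological: `G_div(X)` centralizes `B`): every element of
the `ℂ`-span of the pull-backs commutes with every `u ∈ S(A)(h)(ℂ) ≤ (C(A) ⊗ ℂ)^×`.
[cite: MoonenZarhin1998WeilClasses, §1 Lemma (3) (chunk p0003)] [cite: Milne1999LefschetzClasses, §1 p. 644] -/
theorem comm_of_mem_span_pullbackOne {T : Module.End ℂ (complexBetti A.X 1)}
    (hT : T ∈ Submodule.span ℂ (Set.range fun φ : A ⟶ A ↦ pullbackOne A φ))
    {u : complexBetti A.X 1 ≃ₗ[ℂ] complexBetti A.X 1} (hu : u ∈ unitaryCentralizerGroup A h)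
    (y : complexBetti A.X 1) : T (u y) = u (T y) := by
  have huC := mem_centralizerGroup_iff.1 (unitaryCentralizerGroup_le_centralizerGroup hu)
  induction hT using Submodule.span_induction generalizing y with
  | mem S hS =>
    obtain ⟨φ, rfl⟩ := hS
    exact (huC φ y).symm
  | zero => simp only [LinearMap.zero_apply, map_zero]
  | add S S' _ _ hS hS' => simp only [LinearMap.add_apply, map_add, hS, hS']
  | smul a S _ hS => simp only [LinearMap.smul_apply, map_smul, hS]

/-- **Moonen–Zarhin 1998, Lemma (3), first clause «`End(V_X)^{G_div(X)} = B`» with `G_div = S(A)(h)(ℂ)`,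
`B = End⁰(X)`, on the carrier**: for `h ∈ B¹(A) ⊗ ℂ`, an endomorphism of `H¹(A(ℂ); ℂ)` commutes with every
`u ∈ S(A)(h)(ℂ)` iff it lies in the `ℂ`-span of the pull-backs `φ^*`, `φ ∈ End(A)`.
[cite: MoonenZarhin1998WeilClasses, §1 Lemma (3) (chunk p0003)] [cite: Deligne1982HodgeCycles, I §3, Prop. 3.4] -/
theorem mem_span_pullbackOne_iff_forall_mem_unitaryCentralizerGroup_comm (hh : h ∈ hodgeClassSpan A.dim A.X 1)
    (T : Module.End ℂ (complexBetti A.X 1)) :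
    T ∈ Submodule.span ℂ (Set.range fun φ : A ⟶ A ↦ pullbackOne A φ) ↔
      ∀ u ∈ unitaryCentralizerGroup A h, ∀ y : complexBetti A.X 1, T (u y) = u (T y) :=
  ⟨fun hT _ hu y ↦ comm_of_mem_span_pullbackOne hT hu y,
    mem_span_pullbackOne_of_forall_mem_unitaryCentralizerGroup_comm hh T⟩

/-! ## Part 2. The centre of `S(A)(h)(ℂ)` lies in the span of the central pull-backs (Lemma (1), `Z ⊂ U_{K_B}`) -/

/-- A central element of `S(A)(h)(ℂ)` commutes with the Hodge group `Hg(A)(ℂ)` on `H¹` (`h ∈ B¹(A) ⊗ ℂ`,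
so that `Hg(A)(ℂ)|_{H¹} ≤ S(A)(h)(ℂ)`). [cite: MoonenZarhin1998WeilClasses, §1 Lemma (1) (chunk p0002)]
[cite: Milne1999LefschetzClasses, §1 p. 644] -/
theorem apply_hodgeGroup_eq_of_mem_center_unitaryCentralizerGroup (hh : h ∈ hodgeClassSpan A.dim A.X 1)
    {z : unitaryCentralizerGroup A h} (hz : z ∈ Subgroup.center (unitaryCentralizerGroup A h))
    {g : ∀ k : ℕ, complexBetti A.X k ≃ₗ[ℂ] complexBetti A.X k} (hg : g ∈ hodgeGroup A.dim A.X)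
    (y : complexBetti A.X 1) :
    (z : complexBetti A.X 1 ≃ₗ[ℂ] complexBetti A.X 1) (g 1 y) =
      g 1 ((z : complexBetti A.X 1 ≃ₗ[ℂ] complexBetti A.X 1) y) := by
  have hg1 : g 1 ∈ unitaryCentralizerGroup A h :=
    hodgeGroupOne_le_unitaryCentralizerGroup hh (mem_hodgeGroupOne_iff.2 ⟨g, hg, rfl⟩)
  have hzg := Subgroup.mem_center_iff.1 hz ⟨g 1, hg1⟩
  have e := LinearEquiv.congr_fun (congrArg Subtype.val hzg) y
  change (g 1 * (z : complexBetti A.X 1 ≃ₗ[ℂ] complexBetti A.X 1)) y =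
    ((z : complexBetti A.X 1 ≃ₗ[ℂ] complexBetti A.X 1) * g 1) y at e
  rw [LinearEquiv.mul_apply, LinearEquiv.mul_apply] at e
  exact e.symm

/-- **Moonen–Zarhin 1998, Lemma (1) «the center of `G_div(X)` is the group `U_{K_B}` …
`⊆ (K_B ⊗ R)^*`», the inclusion into the centre of the endomorphism algebra, with `G_div = S(A)(h)(ℂ)`**:
for `h ∈ B¹(A) ⊗ ℂ`, a central element `z` of `S(A)(h)(ℂ)`, viewed as an endomorphism of `H¹(A(ℂ); ℂ)`, lies
in the `ℂ`-span of the CENTRAL pull-backs `u^*` (`u^* ∈ C(A) ⊗ ℂ`, i.e. `u^*` commutes with every `φ^*`) —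
`z` commutes with `Hg(A)(ℂ)` and with every `φ^*`, and `HodgeGroupSemisimple.mem_span_pullbackOne_of_commute`
(Deligne I 3.4 + Riemann with Galois descent) applies.  The torus/finite structure of `U_{K_B}` is §3.
[cite: MoonenZarhin1998WeilClasses, §1 Lemma (1) (chunk p0002)] [cite: Deligne1982HodgeCycles, I §3, Prop. 3.4] -/
theorem coe_mem_span_central_pullbackOne_of_mem_center_unitaryCentralizerGroup
    (hh : h ∈ hodgeClassSpan A.dim A.X 1)
    {z : unitaryCentralizerGroup A h} (hz : z ∈ Subgroup.center (unitaryCentralizerGroup A h)) :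
    ((z : complexBetti A.X 1 ≃ₗ[ℂ] complexBetti A.X 1) : Module.End ℂ (complexBetti A.X 1)) ∈
      Submodule.span ℂ {Y : Module.End ℂ (complexBetti A.X 1) |
        ∃ u : A ⟶ A, Y = pullbackOne A u ∧ pullbackOne A u ∈ centralizerAlgebra A} := by
  refine HodgeGroupSemisimple.mem_span_pullbackOne_of_commute A _ (fun g hg y ↦ ?_) (fun φ y ↦ ?_)
  · exact apply_hodgeGroup_eq_of_mem_center_unitaryCentralizerGroup hh hz hg y
  · exact mem_centralizerGroup_iff.1 (unitaryCentralizerGroup_le_centralizerGroup z.2) φ y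

/-- In particular a central `z ∈ S(A)(h)(ℂ)` lies in the `ℂ`-span of all pull-backs `φ^*` — it is an element
of `End⁰(A) ⊗ ℂ` read on `H¹` (Lemma (1) with Lemma (3): `Z(G_div) ⊂ B ⊗ ℂ`).
[cite: MoonenZarhin1998WeilClasses, §1 Lemma (1), (3) (chunks p0002–p0003)] -/
theorem coe_mem_span_pullbackOne_of_mem_center_unitaryCentralizerGroup (hh : h ∈ hodgeClassSpan A.dim A.X 1)
    {z : unitaryCentralizerGroup A h} (hz : z ∈ Subgroup.center (unitaryCentralizerGroup A h)) :
    ((z : complexBetti A.X 1 ≃ₗ[ℂ] complexBetti A.X 1) : Module.End ℂ (complexBetti A.X 1)) ∈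
      Submodule.span ℂ (Set.range fun φ : A ⟶ A ↦ pullbackOne A φ) :=
  mem_span_pullbackOne_of_forall_mem_unitaryCentralizerGroup_comm hh _ fun u hu y ↦ by
    have e := LinearEquiv.congr_fun (congrArg Subtype.val (Subgroup.mem_center_iff.1 hz ⟨u, hu⟩)) y
    change (u * (z : complexBetti A.X 1 ≃ₗ[ℂ] complexBetti A.X 1)) y =
      ((z : complexBetti A.X 1 ≃ₗ[ℂ] complexBetti A.X 1) * u) y at e
    rw [LinearEquiv.mul_apply, LinearEquiv.mul_apply] at e
    exact e.symm

/-! ## Part 3. No factor of type IV: central elements of `S(A)(h)(ℂ)` are involutions; the centre is finite -/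

/-- **Moonen–Zarhin 1998, Lemma (1) for types 1–3: the centre of `G_div(X)(ℂ) = S(A)(h)(ℂ)` is an elementary
abelian `2`-group** — the carrier form of «`Z(G_div) = U_{K_B} = {a | a a† = 1}`» with `†` trivial on the
totally real `K_B` (`HasNoTypeIVFactor A`: central endomorphisms have real spectrum): for a polarization class
`h` (rational, of type `(1,1)`, hard Lefschetz, Hodge–Riemann positive on `H^{1,0}`), a central `z ∈ S(A)(h)(ℂ)`
lies in the span of the central pull-backs (Part 2), hence is symmetric for `B = coord ∘ Q_h`
(`HodgeGroupSemisimple.isAdj_self_pullbackOne`), and preserves `B`; so `B(x, y) = B(zx, zy) = B(x, z²y)` and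
`z² = 1` by non-degeneracy (hard Lefschetz). [cite: MoonenZarhin1998WeilClasses, §1 Lemma (1) (chunk p0002)]
[cite: MoonenZarhin1999LowDim, §1] [cite: LangeBirkenhake1992, §5.1 (Rosati involution)] -/
theorem mul_self_eq_one_of_mem_center_unitaryCentralizerGroup (h1 : 1 ≤ A.dim) (hA4 : HasNoTypeIVFactor A)
    (hQ : IsRationalClass h) (h11 : IsOfHodgeType A.dim A.X 2 1 1 h) (hHL : HasHardLefschetzProperty h A.dim)
    (hposQ : ∀ x ∈ hodgeOneZero (AbelianVariety.isSmoothProjective_holds (A := A)), x ≠ 0 →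
      polarizationPairingOne A.X h (A.dim - 1) x (conjClass (ComplexPoints A.X) 1 x) ≠ 0)
    {z : unitaryCentralizerGroup A h} (hz : z ∈ Subgroup.center (unitaryCentralizerGroup A h)) :
    z * z = 1 := by
  have hX : IsSmoothProjective A.dim A.X := AbelianVariety.isSmoothProjective_holds
  haveI : FiniteDimensional ℂ (complexBetti A.X 1) := finite_complexBetti_abelianVariety A 1
  have hh : h ∈ hodgeClassSpan A.dim A.X 1 := Submodule.subset_span
    (show h ∈ {c : complexBetti A.X (2 * 1) | IsRationalClass c ∧ IsOfHodgeType A.dim A.X (2 * 1) 1 1 c}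
      from ⟨hQ, h11⟩)
  obtain ⟨coord, hci, hcconj⟩ := HodgeGroupSemisimple.exists_coord (A := A) h1
  set Q := polarizationPairingOne A.X h (A.dim - 1) with hQdef
  set B : LinearMap.BilinForm ℂ (complexBetti A.X 1) := Q.compr₂ coord with hBdef
  have hBapply : ∀ x y, B x y = coord (Q x y) := fun x y ↦ rfl
  have hc0 : ∀ w, coord w = 0 → w = 0 := fun w hw ↦ hci (by rw [hw, map_zero])
  have hBalt : ∀ x y, B y x = -B x y := fun x y ↦ by
    rw [hBapply, hBapply, hQdef, polarizationPairingOne_swap, map_neg]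
  have hBnd : B.Nondegenerate := by
    refine ⟨fun x hx ↦ ?_, fun y hy ↦ ?_⟩
    · exact Milne1999.eq_zero_of_forall_polarizationPairingOne_eq_zero_of_hasHardLefschetzProperty h1 hHL
        fun y ↦ hc0 _ (hx y)
    · refine Milne1999.eq_zero_of_forall_polarizationPairingOne_eq_zero_of_hasHardLefschetzProperty h1 hHL
        fun x ↦ ?_
      have e := hc0 _ (hy x)
      rw [hQdef] at e
      rw [polarizationPairingOne_swap, e, neg_zero]
  have hBcj : ∀ x y, B (conjClass (ComplexPoints A.X) 1 x) (conjClass (ComplexPoints A.X) 1 y) =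
      starRingEnd ℂ (B x y) := fun x y ↦ by
    rw [hBapply, hBapply, hQdef, ← conjClass_polarizationPairingOne hQ, hcconj]
  have hpos : ∀ x ∈ hodgeOneZero hX, x ≠ 0 → B x (conjClass (ComplexPoints A.X) 1 x) ≠ 0 :=
    fun x hx hx0 h0 ↦ hposQ x hx hx0 (hc0 _ h0)
  have hBinv : ∀ w ∈ hodgeGroupOne A.dim A.X, ∀ x y : complexBetti A.X 1, B (w x) (w y) = B x y := by
    intro w hw x y
    rw [hBapply, hBapply, hQdef,
      (Milne1999.hodgeGroupOne_le_unitaryCentralizerGroup_of_isRationalClass hQ h11 hw).2 x y]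
  -- `z` preserves `B`
  have hzB : ∀ x y : complexBetti A.X 1,
      B ((z : complexBetti A.X 1 ≃ₗ[ℂ] complexBetti A.X 1) x) ((z : complexBetti A.X 1 ≃ₗ[ℂ] complexBetti A.X 1) y) =
        B x y := fun x y ↦ by
    rw [hBapply, hBapply, hQdef, z.2.2 x y]
  -- the central element as an endomorphism `T`
  set T : Module.End ℂ (complexBetti A.X 1) :=
    ((z : complexBetti A.X 1 ≃ₗ[ℂ] complexBetti A.X 1) : Module.End ℂ (complexBetti A.X 1)) with hTdef
  have hT : ∀ y, T y = (z : complexBetti A.X 1 ≃ₗ[ℂ] complexBetti A.X 1) y := fun _ ↦ rfl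
  -- every element of the span of the central pull-backs is `B`-symmetric, in particular `T`
  have key : ∀ S ∈ Submodule.span ℂ {Y : Module.End ℂ (complexBetti A.X 1) |
      ∃ u : A ⟶ A, Y = pullbackOne A u ∧ pullbackOne A u ∈ centralizerAlgebra A},
      ∀ x y, B (S x) y = B x (S y) := by
    intro S hS
    induction hS using Submodule.span_induction with
    | mem S hS =>
      obtain ⟨u, rfl, huC⟩ := hS
      exact HodgeGroupSemisimple.isAdj_self_pullbackOne hBalt hBnd hBcj hpos hBinv hA4 u huC
    | zero =>
      intro x y
      simp only [LinearMap.zero_apply, map_zero, LinearMap.zero_apply]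
    | add S S' _ _ hS hS' =>
      intro x y
      simp only [LinearMap.add_apply, map_add, hS, hS']
    | smul a S _ hS =>
      intro x y
      simp only [LinearMap.smul_apply, map_smul, hS, LinearMap.smul_apply, smul_eq_mul]
  have hsymm : ∀ x y, B (T x) y = B x (T y) :=
    key T (coe_mem_span_central_pullbackOne_of_mem_center_unitaryCentralizerGroup hh hz)
  -- `z² = 1`
  have hzz : ∀ y, (z : complexBetti A.X 1 ≃ₗ[ℂ] complexBetti A.X 1)
      ((z : complexBetti A.X 1 ≃ₗ[ℂ] complexBetti A.X 1) y) = y := fun y ↦ by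
    -- non-degeneracy on the right
    have hR : ∀ {y y' : complexBetti A.X 1}, (∀ x, B x y = B x y') → y = y' := by
      intro y y' hyy
      have : y - y' = 0 := hBnd.2 (y - y') fun x ↦ by rw [map_sub, hyy x, sub_self]
      exact sub_eq_zero.1 this
    refine hR fun x ↦ ?_
    calc B x ((z : complexBetti A.X 1 ≃ₗ[ℂ] complexBetti A.X 1)
          ((z : complexBetti A.X 1 ≃ₗ[ℂ] complexBetti A.X 1) y))
        = B x (T (T y)) := by rw [hT, hT]
      _ = B (T x) (T y) := (hsymm x (T y)).symm
      _ = B ((z : complexBetti A.X 1 ≃ₗ[ℂ] complexBetti A.X 1) x)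
          ((z : complexBetti A.X 1 ≃ₗ[ℂ] complexBetti A.X 1) y) := by rw [hT, hT]
      _ = B x y := hzB x y
  apply Subtype.ext
  rw [Subgroup.coe_mul, Subgroup.coe_one]
  exact LinearEquiv.ext fun y ↦ by rw [LinearEquiv.mul_apply]; exact hzz y

/-- **Moonen–Zarhin 1998, Lemma (1) «in all other cases it [the center of `G_div(X)`] is finite», for `A`
with no factor of type IV and `G_div = S(A)(h)(ℂ)`** (`h` a polarization class as in
`mul_self_eq_one_of_mem_center_unitaryCentralizerGroup`): the centre of `S(A)(h)(ℂ)` is a commutative group of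
involutions of `H¹(A(ℂ); ℂ)`, hence finite. [cite: MoonenZarhin1998WeilClasses, §1 Lemma (1) (chunk p0002)]
[cite: MoonenZarhin1999LowDim, §1] -/
theorem finite_center_unitaryCentralizerGroup (h1 : 1 ≤ A.dim) (hA4 : HasNoTypeIVFactor A)
    (hQ : IsRationalClass h) (h11 : IsOfHodgeType A.dim A.X 2 1 1 h) (hHL : HasHardLefschetzProperty h A.dim)
    (hposQ : ∀ x ∈ hodgeOneZero (AbelianVariety.isSmoothProjective_holds (A := A)), x ≠ 0 →
      polarizationPairingOne A.X h (A.dim - 1) x (conjClass (ComplexPoints A.X) 1 x) ≠ 0) :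
    Finite (Subgroup.center (unitaryCentralizerGroup A h)) := by
  haveI : FiniteDimensional ℂ (complexBetti A.X 1) := finite_complexBetti_abelianVariety A 1
  let C : Subgroup (complexBetti A.X 1 ≃ₗ[ℂ] complexBetti A.X 1) :=
    (Subgroup.center (unitaryCentralizerGroup A h)).map (unitaryCentralizerGroup A h).subtype
  have hC : Finite C := by
    refine LefschetzGroupCentre.finite_of_comm_of_mul_self_eq_one C (fun a ha b hb ↦ ?_) (fun a ha ↦ ?_)
    · obtain ⟨za, hza, rfl⟩ := Subgroup.mem_map.1 ha
      obtain ⟨zb, hzb, rfl⟩ := Subgroup.mem_map.1 hb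
      have e := Subgroup.mem_center_iff.1 hza zb
      change (za : complexBetti A.X 1 ≃ₗ[ℂ] complexBetti A.X 1) * zb = zb * za
      rw [← Subgroup.coe_mul, ← Subgroup.coe_mul, e]
    · obtain ⟨za, hza, rfl⟩ := Subgroup.mem_map.1 ha
      have e := mul_self_eq_one_of_mem_center_unitaryCentralizerGroup h1 hA4 hQ h11 hHL hposQ hza
      change (za : complexBetti A.X 1 ≃ₗ[ℂ] complexBetti A.X 1) * za = 1
      rw [← Subgroup.coe_mul, e, Subgroup.coe_one]
  refine Finite.of_injective (fun z : Subgroup.center (unitaryCentralizerGroup A h) ↦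
    (⟨((z : unitaryCentralizerGroup A h) : complexBetti A.X 1 ≃ₗ[ℂ] complexBetti A.X 1),
      Subgroup.mem_map.2 ⟨z.1, z.2, rfl⟩⟩ : C)) fun z₁ z₂ hzz ↦ ?_
  simp only [Subtype.mk.injEq] at hzz
  exact Subtype.ext (Subtype.ext hzz)

/-- **Lemma (1), finiteness, packaged for `dim A ≥ 1`**: a complex abelian variety with no factor of type IV
carries a rational polarization class `h` of type `(1,1)` for which the centre of `S(A)(h)(ℂ)` is finite
(`HodgeGroupSemisimple.exists_polarizationClass`). [cite: MoonenZarhin1998WeilClasses, §1 Lemma (1) (chunk p0002)]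
[cite: MoonenZarhin1999LowDim, §1] -/
theorem exists_finite_center_unitaryCentralizerGroup (h1 : 1 ≤ A.dim) (hA4 : HasNoTypeIVFactor A) :
    ∃ h : complexBetti A.X 2, IsRationalClass h ∧ IsOfHodgeType A.dim A.X 2 1 1 h ∧
      HasHardLefschetzProperty h A.dim ∧ Finite (Subgroup.center (unitaryCentralizerGroup A h)) := by
  obtain ⟨h, hQ, h11, hHL, hposQ⟩ := HodgeGroupSemisimple.exists_polarizationClass (A := A) h1
  exact ⟨h, hQ, h11, hHL, finite_center_unitaryCentralizerGroup h1 hA4 hQ h11 hHL hposQ⟩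

/-- **The centre of `S(A)(h)(ℂ)` has exponent `2`** — a central `z` commutes with every `z'` and `z² = 1`
(the group-theoretic content of «`U_{K_B}` … finite» for types 1–3, recorded as a pair for consumers).
[cite: MoonenZarhin1998WeilClasses, §1 Lemma (1) (chunk p0002)] -/
theorem center_unitaryCentralizerGroup_comm_and_mul_self (h1 : 1 ≤ A.dim) (hA4 : HasNoTypeIVFactor A)
    (hQ : IsRationalClass h) (h11 : IsOfHodgeType A.dim A.X 2 1 1 h) (hHL : HasHardLefschetzProperty h A.dim)
    (hposQ : ∀ x ∈ hodgeOneZero (AbelianVariety.isSmoothProjective_holds (A := A)), x ≠ 0 →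
      polarizationPairingOne A.X h (A.dim - 1) x (conjClass (ComplexPoints A.X) 1 x) ≠ 0)
    {z : unitaryCentralizerGroup A h} (hz : z ∈ Subgroup.center (unitaryCentralizerGroup A h))
    (z' : unitaryCentralizerGroup A h) :
    z * z' = z' * z ∧ z * z = 1 :=
  ⟨(Subgroup.mem_center_iff.1 hz z').symm,
    mul_self_eq_one_of_mem_center_unitaryCentralizerGroup h1 hA4 hQ h11 hHL hposQ hz⟩

end Literature.AlgebraicGeometry.HodgeTheory

end
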